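import Summits.RiemannHypothesis.RiemannHypothesis.Theorems.WeilColumnThetaWitness
import Summits.RiemannHypothesis.RiemannHypothesis.Theorems.WeilColumnBSplineContinuity
import HarnessLib

/-!
# Witness basics in the interface's names: continuity of the profile, `ProfileHyp` for `G`, and D1 WITHOUT the continuity hypothesis

WEIL column (LADDER-RH, W-P(P2); tier-1 `ThetaCertificateSound`, THETA-ASSIGN v1.0 §3 glue). With handoff-prove-2's
`WeilColumnBSplineContinuity` (p421408: `continuous_bsplineDensity`, `continuous_profile_of_two_le`) the hypothesis `hcont` of
`ThetaParams.norm_Θ_le` (p418783) is discharged for every admissible row (`3 ≤ m`):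
* `ThetaParams.continuous_smoothingDensity` (the names `continuous_h`, `x₁_neg`, `norm_Θ_le'` live in handoff-prove-2's `WeilColumnThetaCut`);
* `ThetaParams.profileHyp_G : ProfileHyp P.G (lam·c₁) (lam·c₂)` (so every `ProfileHyp.*` lemma of `WeilColumnThetaMellin` applies to
  the witness: local finiteness, continuity on `(0,∞)`, Mellin convergence, (Z1));
* the lane's shape **`ThetaParams.D1_on_Ioc`**: `∀ u ∈ Ioc 0 u₁, ‖Θ u‖ ≤ M·(u/u₁)^m` (hypothesis-free);
* `ThetaParams.M_nonneg`, `ThetaParams.u₁_eq_exp`, `ThetaParams.lam_mul_c₂`, `ThetaParams.Θ_eq_zero_of_lt`, `ThetaParams.continuousOn_Θ`.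
RH-free; nothing here bears on the truth of RH.
-/

set_option linter.dupNamespace false

noncomputable section

open MeasureTheory Set Complex Filter
open scoped Real
open Literature.NumberTheory.LFunctions

namespace Summit.RiemannHypothesis.RiemannHypothesis.Theorems.WeilColumn.ThetaMellin

namespace ThetaParams

variable (P : ThetaParams)

/-- The smoothing density `bsplineDensity (ε/m) (m−1)` of an admissible row is continuous (`m ≥ 2`, `ε > 0`). [folklore] -/
theorem continuous_smoothingDensity {qn : ℕ} (hP : P.Admissible qn) : Continuous (bsplineDensity (P.ε / P.m) (P.m - 1)) := by
  have hm : 2 ≤ P.m := le_trans (by norm_num) hP.three_le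
  have hε : 0 < P.ε := by have := hP.delta_pos; have := hP.c₂_pos; unfold ε; positivity
  have hm0 : (0 : ℝ) < P.m := by exact_mod_cast (lt_of_lt_of_le (by norm_num) hm)
  exact continuous_bsplineDensity (div_pos hε hm0) (by omega)

/-- Continuity of the witness profile (local helper; the named version is `WeilColumnThetaCut`'s `continuous_h`). -/
private theorem continuous_h_aux {qn : ℕ} (hP : P.Admissible qn) : Continuous P.h := by
  have hm : 2 ≤ P.m := le_trans (by norm_num) hP.three_le
  have hε : 0 < P.ε := by have := hP.delta_pos; have := hP.c₂_pos; unfold ε; positivity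
  exact continuous_profile_of_two_le hm hε

/-- `u₁ = e^{x₁}`. [folklore] -/
theorem u₁_eq_exp : P.u₁ = Real.exp P.x₁ := rfl

/-- `0 ≤ M`. [folklore] -/
theorem M_nonneg {qn : ℕ} (hP : P.Admissible qn) : 0 ≤ P.M := by
  have hα : 0 ≤ P.α := div_nonneg (by linarith [hP.seed₂]) (by linarith [hP.seed₁])
  have hcs : 0 ≤ P.csum := by unfold csum; linarith
  have hz : 0 ≤ zetaTail (P.m + 1) := tsum_nonneg fun n => by positivity
  have hε : 0 < P.ε := by have := hP.delta_pos; have := hP.c₂_pos; unfold ε; positivity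
  have hlam : 0 < P.lam := by have := hP.c₂_pos; unfold lam; positivity
  have hzs : 0 < P.zstar := by unfold zstar u₁; positivity
  unfold M; positivity

/-- `ProfileHyp` for the scaled witness profile `G = h(·/λ)` on `[λc₁, λc₂]`. [folklore] -/
theorem profileHyp_G {qn : ℕ} (hP : P.Admissible qn) : ProfileHyp P.G (P.lam * P.c₁) (P.lam * P.c₂) := by
  have hm : 1 ≤ P.m := le_trans (by norm_num) hP.three_le
  have hε : 0 ≤ P.ε := by have := hP.delta_pos; have := hP.c₂_pos; unfold ε; positivity
  have hlam : 0 < P.lam := by have := hP.c₂_pos; unfold lam; positivity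
  have hle : P.c₁ ≤ P.c₂ := by linarith [hP.seed₁, hP.seed₂]
  refine ⟨(P.continuous_h_aux hP).comp (continuous_id.div_const _), mul_pos hlam hP.c₁_pos,
    mul_le_mul_of_nonneg_left hle hlam.le, fun t ht => ?_⟩
  refine Function.notMem_support.mp fun hmem => ht ?_
  have hsub := support_profile_subset (α := P.α) hm hε hP.seed₂.le hP.seed₁.le hmem
  constructor
  · have := (le_div_iff₀ hlam).mp hsub.1; linarith
  · have := (div_le_iff₀ hlam).mp hsub.2; linarith

/-- **D1 in the lane's shape** (hypothesis `hM` of `WeilColumnThetaTailNorms` / `…ThetaPrime*`). [this seat, D1] -/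
theorem D1_on_Ioc {qn : ℕ} (hP : P.Admissible qn) : ∀ u ∈ Ioc (0 : ℝ) P.u₁, ‖P.Θ u‖ ≤ P.M * (u / P.u₁) ^ P.m :=
  fun _ hu => P.norm_Θ_le hP (P.continuous_h_aux hP) hu.1

/-- The theta series of the witness vanishes above `λc₂ = eᵃ`. [folklore] -/
theorem Θ_eq_zero_of_lt {qn : ℕ} (hP : P.Admissible qn) {t : ℝ} (ht : P.lam * P.c₂ < t) : P.Θ t = 0 :=
  (P.profileHyp_G hP).thetaSum_eq_zero ht (lt_trans (mul_pos (by have := hP.c₂_pos; unfold lam; positivity) hP.c₂_pos) ht)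

/-- `λ·c₂ = eᵃ`. [folklore] -/
theorem lam_mul_c₂ {qn : ℕ} (hP : P.Admissible qn) : P.lam * P.c₂ = Real.exp P.a := by
  have := hP.c₂_pos.ne'; unfold lam; field_simp

/-- The theta series of the witness is continuous on `(0, ∞)`. [folklore] -/
theorem continuousOn_Θ {qn : ℕ} (hP : P.Admissible qn) : ContinuousOn P.Θ (Ioi 0) :=
  (P.profileHyp_G hP).continuousOn_thetaSum

end ThetaParams

end Summit.RiemannHypothesis.RiemannHypothesis.Theorems.WeilColumn.ThetaMellin
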